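import Summits.NavierStokesRegularity.NavierStokesRegularity.Theorems.ScenarioCensusRowF19obSigned

/-!
# Census row F19 family, member F19ob «observer tops / the force floor» — part 4/4: census keys

Re-homed for the scenario census (typer seat ns-census-typer-2 g8; lead g7 GO 2026-08-28T17:18Z [1/2][2/2]) from ns-idea-3
LINE 12 «observer-top» REV 2 (sha16 d9972826d387f45a), continuing `ScenarioCensusRowF19obTop` / `…Schema` / `…Signed`
(parts 1–3, the line VERBATIM in namespace `…Theorems.ScenarioCensus.ObserverTop`).  ROW POLICY 15:11Z / cen9 (2): these are
TREE records of MEMBERS of the F19 family row (keyed by `Row_F19 = QuasiSteadyTop.Row_Fqs`), not new rows.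

Census keys (namespace `…Theorems.ScenarioCensus`), each an alias BY NAME of the line's decl + its `_excluded` closer:
`Row_F19ob` (= `ObserverTop.Row_Fobs`, the observer schema), `Row_F19obP` (= `Row_Pobs`, signed schema ⊋ F-obs),
`Row_F19tw` (= `Row_Ftw`, Galilean observers), `Row_F19acc` (= `Row_Facc`, ballistic top), `Row_F19force` (= `Row_Fforce`,
force-free top), `Row_F19lab` (= `Row_Plab`, one-sided lab observer), `Row_F19pow` (= `Row_Ppow`, subcritical power),
`Row_F1acc` (= `Row_F1acc`, Type-I member); lattice `row_F19ob_of_row_F1a`, `row_F19ob_of_row_F19obP`,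
`row_F19tw_of_row_F19ob`, `row_F19acc_of_row_F19ob`, `row_F19force_of_row_F19acc`; display `row_F1_iff_typeIBallisticity`.
Structural theorems stay BY NAME in `ObserverTop` (`observerUnsteadiness_holds`, `forceFloor_holds`, `gainFloor_holds`).

No census value is asserted here (the lead books the F19 family); NS regularity is NOT proved; `Row_F1` stays open
(≡ `ObserverTop.TypeIBallisticity`); no summit statement is proved by this file.
-/

noncomputable section

set_option linter.dupNamespace false

namespace Summit.NavierStokesRegularity.NavierStokesRegularity.Theorems.ScenarioCensus

/-- F19 family member F19ob — (I ∨ II, NO rate · forward, Clay frame · no symmetry; instead an OBSERVER FIELD `b` admissible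
from every interior time (backward characteristics) for which the top is quasi-steady: `‖∂ₜu + (b·∇)u‖ ≤ δ√ν (T−t)^{-3/2}` at all
fast points near `T`, `0 ≤ δ < 9 − 2√15`): extends past `T`, BY NAME `ObserverTop.Row_Fobs` (ns-idea-3 LINE 12, VERBATIM). -/
def Row_F19ob : Prop := ObserverTop.Row_Fobs

/-- F19ob is PROVED in the tree: `ObserverTop.rowFobs_holds` (fencing along characteristics + row F1a).  No summit proved. -/
theorem row_F19ob_excluded : Row_F19ob := ObserverTop.rowFobs_holds

/-- F19 family member F19obP (SIGNED schema ⊋ F19ob: only speed GAIN is fenced, `⟪u, ∂ₜu + (b·∇)u⟫ ≤ δ√ν (T−t)^{-3/2}|u|` at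
fast points), BY NAME `ObserverTop.Row_Pobs`. -/
def Row_F19obP : Prop := ObserverTop.Row_Pobs

/-- F19obP is PROVED in the tree: `ObserverTop.rowPobs_holds`. -/
theorem row_F19obP_excluded : Row_F19obP := ObserverTop.rowPobs_holds

/-- F19 family member F19tw (Galilean observers `b ≡ c`, «travelling-wave top» ⊃ F19 = lab observer), BY NAME
`ObserverTop.Row_Ftw`. -/
def Row_F19tw : Prop := ObserverTop.Row_Ftw

/-- F19tw is PROVED in the tree: `ObserverTop.rowFtw_holds`. -/
theorem row_F19tw_excluded : Row_F19tw := ObserverTop.rowFtw_holds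

/-- F19 family member F19acc (the Lagrangian observer `b = u`, «ballistic top»: acceleration `‖∂ₜu + (u·∇)u‖ ≤ δ√ν (T−t)^{-3/2}`
at fast particles), BY NAME `ObserverTop.Row_Facc`. -/
def Row_F19acc : Prop := ObserverTop.Row_Facc

/-- F19acc is PROVED in the tree: `ObserverTop.rowFacc_holds` (characteristics by Picard–Lindelöf). -/
theorem row_F19acc_excluded : Row_F19acc := ObserverTop.rowFacc_holds

/-- F19 family member F19force (= F19acc read through the momentum equation: net force `‖νΔu − ∇p‖ ≤ δ√ν (T−t)^{-3/2}` at fast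
points), BY NAME `ObserverTop.Row_Fforce`. -/
def Row_F19force : Prop := ObserverTop.Row_Fforce

/-- F19force is PROVED in the tree: `ObserverTop.rowFforce_holds`. -/
theorem row_F19force_excluded : Row_F19force := ObserverTop.rowFforce_holds

/-- F19 family member F19lab (signed lab observer: `⟪u, ∂ₜu⟫ ≤ δ√ν (T−t)^{-3/2}|u|` on the top — the one-sided form of F19),
BY NAME `ObserverTop.Row_Plab`. -/
def Row_F19lab : Prop := ObserverTop.Row_Plab

/-- F19lab is PROVED in the tree: `ObserverTop.rowPlab_holds`. -/
theorem row_F19lab_excluded : Row_F19lab := ObserverTop.rowPlab_holds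

/-- F19 family member F19pow (the POWER of the net force on fast particles is subcritical:
`⟪u, νΔu − ∇p⟫ ≤ δ√ν (T−t)^{-3/2}|u|`), BY NAME `ObserverTop.Row_Ppow`. -/
def Row_F19pow : Prop := ObserverTop.Row_Ppow

/-- F19pow is PROVED in the tree: `ObserverTop.rowPpow_holds`. -/
theorem row_F19pow_excluded : Row_F19pow := ObserverTop.rowPpow_holds

/-- In-family Type-I member F1acc (frame of `Row_F1` verbatim + ballistic top), BY NAME `ObserverTop.Row_F1acc`. -/
def Row_F1acc : Prop := ObserverTop.Row_F1acc

/-- F1acc is PROVED in the tree: `ObserverTop.rowF1acc_holds`. -/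
theorem row_F1acc_excluded : Row_F1acc := ObserverTop.rowF1acc_holds

/-- Lattice: F1a ⇒ F19ob BY NAME (`ObserverTop.rowFobs_of_rowF1a`: the cell sits inside the quiet window F1a). -/
theorem row_F19ob_of_row_F1a (h : Row_F1a) : Row_F19ob := ObserverTop.rowFobs_of_rowF1a h

/-- Lattice: F19obP ⇒ F19ob (the signed schema contains the normed one, Cauchy–Schwarz). -/
theorem row_F19ob_of_row_F19obP (h : Row_F19obP) : Row_F19ob := ObserverTop.rowFobs_of_rowPobs h

/-- Lattice: F19ob ⇒ F19tw (Galilean observers are admissible: explicit characteristics). -/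
theorem row_F19tw_of_row_F19ob (h : Row_F19ob) : Row_F19tw := ObserverTop.rowFtw_of_rowFobs h

/-- Lattice: F19ob ⇒ F19acc (the Lagrangian observer is admissible: Picard–Lindelöf on closed sub-slabs). -/
theorem row_F19acc_of_row_F19ob (h : Row_F19ob) : Row_F19acc := ObserverTop.rowFacc_of_rowFobs h

/-- Lattice: F19acc ⇒ F19force (momentum equation). -/
theorem row_F19force_of_row_F19acc (h : Row_F19acc) : Row_F19force := ObserverTop.rowFforce_of_rowFacc h

/-- Display for row F1: `Row_F1 ↔ ObserverTop.TypeIBallisticity` (every Type-I Clay blow-up, maximal frame, has a ballistic top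
with some modulus `< 9 − 2√15`) — an exact reformulation, no value change. -/
theorem row_F1_iff_typeIBallisticity : Row_F1 ↔ ObserverTop.TypeIBallisticity :=
  ObserverTop.typeIBallisticity_iff_rowF1.symm

end Summit.NavierStokesRegularity.NavierStokesRegularity.Theorems.ScenarioCensus

end
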